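import Literature.Analysis.FunctionSpaces.MultiscaleBakryEmery
import Literature.Barriers.CriticalPhenomena.RigorousRGSmallParameterGaussianIntegration
import Mathlib.MeasureTheory.Group.IntegralConvolution
import Mathlib.Analysis.Calculus.Deriv.MeanValue
import Mathlib.Analysis.Calculus.Deriv.Add
import Mathlib.Analysis.Calculus.Deriv.Mul
import HarnessLib

/-!
# The Polchinski semigroup: renormalised potentials, the time-inhomogeneous Markov semigroup
# `P_{s,t}` and its duality with the renormalised measures `ν_t` (Bauerschmidt–Bodineau–Dagallier §3.2)

Topic `Literature/Analysis/FunctionSpaces`; companion ("proof architecture") file of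
`MultiscaleBakryEmery.lean`, which TYPES the multiscale Bakry–Émery criterion [BBD, Theorem 3] as the
named fact `Polchinski.BauerschmidtBodineau_multiscaleBakryEmery` together with its vocabulary
(`Polchinski.CovDecomposition`, `nu0`, `renormPotential`, `renormPotentialInf`, `semigroup`,
`renormExpect`).  The printed proof of Theorem 3 ([BBD] p0016–p0017) runs on the algebraic structure of
§3.2: Proposition 6 (`E_{ν₀}[F] = E_{ν_t}[P_{0,t}F]`), (eq: semigroup structure), and Proposition 8
(`P_{t,t} = id`, `P_{r,t} P_{s,r} = P_{s,t}`, positivity, `P_{s,t}1 = 1`, duality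
`E_{ν_t}[P_{s,t}F] = E_{ν_s}[F]`).  This file PROVES that structure, in the finite-dimensional
rendering of `MultiscaleBakryEmery.lean` (`X = ℝ^N`, possibly DEGENERATE positive semidefinite
`Ċ_t`, `V₀` measurable and bounded below), sorry-free and with no new definition and no new named fact.

Source (held, read this session; locators = page files of `paper:arxiv-2307.07619`):
R. Bauerschmidt, T. Bodineau, B. Dagallier, *Stochastic dynamics and the Polchinski equation: an
introduction*, Probab. Surveys 21 (2024) [BBD]: §3.1 (e:Gauss-conv) p0012; Definition 2 p0013 L33–45;
Proposition 6 p0013 L60–75; (e:fluctuationmeasure-def) p0013 L80–84; (eq: semigroup structure)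
p0014 L40–44; Proposition 8 p0014 L74 – p0015 L12 and its proof p0015 L1–12; Lemma 2's first display
`V_t(φ) = −log E_{C_t−C_s}[e^{−V_s(φ+ζ)}]` p0017 L8.  The same statements: R. Bauerschmidt,
T. Bodineau, *Log-Sobolev inequality for the continuum sine-Gordon model*, CPAM 74 (2021) §2.1,
Proposition 1 and §2.4 (`paper:arxiv-1907.12308` p0008, p0010 L66–110).

## What is proved (all for `D : Polchinski.CovDecomposition N`, `V₀` measurable with `b ≤ V₀`)

* Covariance-decomposition calculus (§3.1): `C_t` is symmetric and positive semidefinite, increasing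
  as quadratic forms (`posSemidef_C_sub : (C_t − C_s) ⪰ 0` for `0 ≤ s ≤ t`), and `C_∞ − C_t ⪰ 0`
  (`posSemidef_Cinf_sub`), from the entrywise derivative hypotheses by the mean-value monotonicity
  lemma and closedness of the positive cone.
* From the tree's Gaussian convolution `P_A ∗ P_B = P_{A+B}` for positive semidefinite `A, B`
  (`LongRangePhi4.multivariateGaussian_conv_multivariateGaussian`, (e:Gauss-conv)) the Fubini identity
  `E_{A+B}[G(φ+·)] = E_A[E_B[G(φ+ζ+·)]]` for bounded measurable `G` (`integral_gaussian_add`).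
* Renormalised potential (Def 2): `e^{−V_t(φ)} = E_{C_t}[e^{−V₀(φ+ζ)}]` (`exp_neg_renormPotential`),
  `V_t ≥ b`, measurability, and the SEMIGROUP OF POTENTIALS `e^{−V_t(φ)} = E_{C_t−C_s}[e^{−V_s(φ+ζ)}]`
  (`exp_neg_renormPotential_eq_integral_sub`, [BBD] p0017 L8) with its `t = ∞` form.
* Polchinski semigroup (Def 2, Prop 8): `P_{t,t} = id` (`semigroup_self`), `P_{s,t}1 = 1`, positivity,
  `|P_{s,t}F| ≤ sup|F|`, the semigroup law `P_{r,t}(P_{s,r}F) = P_{s,t}F` (`semigroup_comp`), the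
  explicit `t = 0` form and the fluctuation-measure form `P_{0,t}F(φ) = E_{μ_t^φ}[F]` with `μ_t^φ` the
  `−V₀(φ+·)`-tilt of `P_{C_t}` ((e:fluctuationmeasure-def), `semigroup_zero_eq_integral_tilted`).
* Renormalised measure (Def 2, Props 6 and 8): `E_{ν_t}` is integration against the probability measure
  `P_{C_∞−C_t}` tilted by `−V_t` (`renormExpect_eq_integral_tilted`), `E_{ν_0} = E_{ν₀}`
  (`renormExpect_zero`), DUALITY `E_{ν_t}[P_{s,t}F] = E_{ν_s}[F]` (`renormExpect_semigroup`) and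
  **Proposition 6** `E_{ν_t}[P_{0,t}F] = E_{ν₀}[F]` (`renormExpect_semigroup_zero`).

What is NOT here: the differential structure (Prop 5 heat equation, Prop 7 Polchinski equation, the
generator `L_t` of Prop 8, `−d/dt E_{ν_t} = E_{ν_t} L_t`) and Theorem 3 itself (named fact
`Polchinski.BauerschmidtBodineau_multiscaleBakryEmery`, not discharged).  Nothing here is a statement
about Yang–Mills or lattice gauge theory.

## References

* [BauerschmidtBodineauDagallier2023] R. Bauerschmidt, T. Bodineau, B. Dagallier, Probab. Surveys 21
  (2024) 200–290, arXiv:2307.07619 — §3.1–3.2, Definition 2, Propositions 6 and 8. READ (held text).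
* [BauerschmidtBodineau2021SineGordonLSI] R. Bauerschmidt, T. Bodineau, Comm. Pure Appl. Math. 74
  (2021) 2064–2113, arXiv:1907.12308 — §2.1 Proposition 1, §2.4. READ (held text).
-/

noncomputable section

open MeasureTheory ProbabilityTheory Filter Topology
open Literature.Barriers.CriticalPhenomena (LongRangePhi4.multivariateGaussian_conv_multivariateGaussian)
open scoped RealInnerProductSpace Matrix MatrixOrder

namespace Literature.Analysis.FunctionSpaces

namespace Polchinski

variable {N : ℕ}

/-! ### Bounded measurable functions on a finite measure space (helpers) -/

/-- A measurable function with a uniform bound is integrable for a finite measure. [folklore] -/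
private theorem integrable_of_abs_le {α : Type*} [MeasurableSpace α] {μ : Measure α} [IsFiniteMeasure μ]
    {G : α → ℝ} (hG : Measurable G) {B : ℝ} (hB : ∀ x, |G x| ≤ B) : Integrable G μ :=
  (integrable_const B).mono' hG.aestronglyMeasurable
    (Eventually.of_forall fun x => by rw [Real.norm_eq_abs]; exact hB x)

/-! ### Gaussian convolution `P_A ∗ P_B = P_{A+B}` ([BBD] §3.1 (e:Gauss-conv)) -/

section Gaussian

variable {ι : Type*} [Fintype ι] [DecidableEq ι]

/-- The Gaussian with ZERO covariance is the point mass at its mean (Mathlib's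
`multivariateGaussian μ 0` is the image of the standard Gaussian under `x ↦ μ + 0`); [BBD] proof of
Prop 8: «the Gaussian measure with covariance `0` is the Dirac measure at `0`».
[cite: BauerschmidtBodineauDagallier2023, Proposition 8 (proof)] -/
theorem multivariateGaussian_zero_cov (μ : EuclideanSpace ℝ ι) :
    multivariateGaussian μ (0 : Matrix ι ι ℝ) = Measure.dirac μ := by
  rw [multivariateGaussian]
  have h0 : CFC.sqrt (0 : Matrix ι ι ℝ) = 0 := CFC.sqrt_zero
  rw [h0, map_zero]
  have : (fun x : EuclideanSpace ℝ ι => μ + (0 : EuclideanSpace ℝ ι →L[ℝ] EuclideanSpace ℝ ι) x) =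
      fun _ => μ := by
    funext x; simp
  rw [this, Measure.map_const, measure_univ, one_smul]

/-- **Gaussian decomposition as an iterated integral** ((e:Gauss-conv) in the form used throughout
[BBD] §3.2): for positive semidefinite `A, B` and a bounded measurable `G`,
`E_{A+B}[G] = E_A[ ζ ↦ E_B[ w ↦ G(ζ + w) ] ]` (Fubini over `P_A ∗ P_B = P_{A+B}`) — «a fundamental
property of the Gaussian measure is its semigroup property: if `C = C₁ + C₂` with `C₁, C₂` also
positive semi-definite then `E_C[F(ζ)] = E_{C₂}[E_{C₁}[F(ζ₁+ζ₂)]]`».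
[cite: BauerschmidtBodineauDagallier2023, §3.1 (e:Gauss-conv) p0012 L19–29] -/
theorem integral_gaussian_add {A B : Matrix ι ι ℝ} (hA : A.PosSemidef) (hB : B.PosSemidef)
    {G : EuclideanSpace ℝ ι → ℝ} (hG : Measurable G) {K : ℝ} (hK : ∀ x, |G x| ≤ K) :
    ∫ x, G x ∂(multivariateGaussian 0 (A + B)) =
      ∫ ζ, ∫ w, G (ζ + w) ∂(multivariateGaussian 0 B) ∂(multivariateGaussian 0 A) := by
  have hconv := LongRangePhi4.multivariateGaussian_conv_multivariateGaussian
    (0 : EuclideanSpace ℝ ι) 0 hA hB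
  rw [add_zero] at hconv
  rw [← hconv]
  have hint : Integrable G (multivariateGaussian 0 A ∗ multivariateGaussian 0 B) := by
    rw [hconv]
    exact integrable_of_abs_le hG fun x => hK _
  rw [integral_conv hint]

/-- Shifted form of `integral_gaussian_add`: `E_{A+B}[G(φ + ·)] = E_A[ ζ ↦ E_B[ w ↦ G(φ + ζ + w) ] ]`
(the variable pattern of [BBD] Def 2 / (eq: semigroup structure)).
[cite: BauerschmidtBodineauDagallier2023, §3.1 (e:Gauss-conv) p0012 L19–29] -/
theorem integral_gaussian_add_shift {A B : Matrix ι ι ℝ} (hA : A.PosSemidef) (hB : B.PosSemidef)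
    {G : EuclideanSpace ℝ ι → ℝ} (hG : Measurable G) {K : ℝ} (hK : ∀ x, |G x| ≤ K)
    (φ : EuclideanSpace ℝ ι) :
    ∫ x, G (φ + x) ∂(multivariateGaussian 0 (A + B)) =
      ∫ ζ, ∫ w, G (φ + ζ + w) ∂(multivariateGaussian 0 B) ∂(multivariateGaussian 0 A) := by
  have h := integral_gaussian_add hA hB (G := fun x => G (φ + x))
    (hG.comp (measurable_const_add φ)) (fun x => hK (φ + x))
  simp_rw [add_assoc]
  exact h

end Gaussian

/-! ### Covariance-decomposition calculus ([BBD] §3.1): symmetry, positivity, monotonicity -/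

section Cov

/-- A real function differentiable on `[0, ∞)` with nonnegative derivative there is monotone on
`[0, ∞)` (mean-value monotonicity). [folklore] -/
private theorem monotoneOn_Ici_of_hasDerivAt {f f' : ℝ → ℝ} (hf : ∀ t, 0 ≤ t → HasDerivAt f (f' t) t)
    (hf' : ∀ t, 0 ≤ t → 0 ≤ f' t) : MonotoneOn f (Set.Ici 0) := by
  refine monotoneOn_of_hasDerivWithinAt_nonneg (f' := f') (convex_Ici 0)
    (fun t ht => (hf t ht).continuousAt.continuousWithinAt) (fun t ht => ?_) fun t ht => ?_
  · rw [interior_Ici] at ht ⊢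
    exact (hf t (le_of_lt ht)).hasDerivWithinAt
  · rw [interior_Ici] at ht
    exact hf' t (le_of_lt ht)

/-- A real function with zero derivative on `[0, ∞)` is constant there. [folklore] -/
private theorem eq_of_hasDerivAt_zero {f : ℝ → ℝ} (hf : ∀ t, 0 ≤ t → HasDerivAt f 0 t) {t : ℝ}
    (ht : 0 ≤ t) : f t = f 0 := by
  have h1 : MonotoneOn f (Set.Ici 0) :=
    monotoneOn_Ici_of_hasDerivAt (f' := fun _ => 0) hf fun _ _ => le_rfl
  have h2 : MonotoneOn (fun s => -f s) (Set.Ici 0) :=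
    monotoneOn_Ici_of_hasDerivAt (f := fun s => -f s) (f' := fun _ => 0)
      (fun s hs => by
        have h := (hf s hs).neg
        rw [neg_zero] at h
        exact h)
      fun _ _ => le_rfl
  have a := h1 (Set.mem_Ici.2 le_rfl) (Set.mem_Ici.2 ht) ht
  have b := h2 (Set.mem_Ici.2 le_rfl) (Set.mem_Ici.2 ht) ht
  simp only [neg_le_neg_iff] at b
  exact le_antisymm b a

namespace CovDecomposition

variable (D : CovDecomposition N)

/-- `Ċ_t` is symmetric for `t ≥ 0` (positive semidefinite matrices are Hermitian).
[cite: BauerschmidtBodineauDagallier2023, §3.1] -/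
theorem Cdot_symm {t : ℝ} (ht : 0 ≤ t) (i j : Fin N) : D.Cdot t j i = D.Cdot t i j := by
  have h := (D.posSemidef_Cdot t ht).1.apply i j
  simpa using h

/-- `C_t` is symmetric for `t ≥ 0`: `C_t = ∫₀^t Ċ_s ds` with `Ċ_s` symmetric (proved from the entrywise
derivative hypotheses: `C_t i j − C_t j i` has zero derivative and vanishes at `0`).
[cite: BauerschmidtBodineauDagallier2023, §3.1] -/
theorem C_symm {t : ℝ} (ht : 0 ≤ t) (i j : Fin N) : D.C t j i = D.C t i j := by
  have hd : ∀ s, 0 ≤ s → HasDerivAt (fun u => D.C u j i - D.C u i j) 0 s := by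
    intro s hs
    have h := (D.hasDerivAt_C s hs j i).sub (D.hasDerivAt_C s hs i j)
    rwa [D.Cdot_symm hs i j, sub_self] at h
  have h := eq_of_hasDerivAt_zero hd ht
  simp only [D.C_zero, Matrix.zero_apply, sub_self] at h
  exact sub_eq_zero.1 h

/-- `C_t` is Hermitian (symmetric) for `t ≥ 0`. [cite: BauerschmidtBodineauDagallier2023, §3.1] -/
theorem isHermitian_C {t : ℝ} (ht : 0 ≤ t) : (D.C t).IsHermitian :=
  Matrix.IsHermitian.ext fun i j => by simpa using D.C_symm ht i j

/-- The quadratic form `t ↦ (x, C_t x)` has derivative `(x, Ċ_t x)` at every `t ≥ 0`.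
[cite: BauerschmidtBodineauDagallier2023, §3.1] -/
theorem hasDerivAt_quadForm_C (x : Fin N → ℝ) {t : ℝ} (ht : 0 ≤ t) :
    HasDerivAt (fun s => x ⬝ᵥ (D.C s *ᵥ x)) (x ⬝ᵥ (D.Cdot t *ᵥ x)) t := by
  have h1 : (fun s => x ⬝ᵥ (D.C s *ᵥ x)) = fun s => ∑ i, ∑ j, x i * (D.C s i j * x j) := by
    funext s
    simp only [dotProduct, Matrix.mulVec, Finset.mul_sum]
  have h2 : x ⬝ᵥ (D.Cdot t *ᵥ x) = ∑ i, ∑ j, x i * (D.Cdot t i j * x j) := by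
    simp only [dotProduct, Matrix.mulVec, Finset.mul_sum]
  rw [h1, h2]
  refine HasDerivAt.fun_sum fun i _ => HasDerivAt.fun_sum fun j _ => ?_
  exact ((D.hasDerivAt_C t ht i j).mul_const (x j)).const_mul (x i)

/-- **`C_t` increases as quadratic forms**: `(x, C_s x) ≤ (x, C_t x)` for `0 ≤ s ≤ t`
(`d/dt (x, C_t x) = (x, Ċ_t x) ≥ 0`). [cite: BauerschmidtBodineauDagallier2023, §3.1] -/
theorem quadForm_C_mono (x : Fin N → ℝ) {s t : ℝ} (hs : 0 ≤ s) (hst : s ≤ t) :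
    x ⬝ᵥ (D.C s *ᵥ x) ≤ x ⬝ᵥ (D.C t *ᵥ x) := by
  have hmono : MonotoneOn (fun u => x ⬝ᵥ (D.C u *ᵥ x)) (Set.Ici 0) :=
    monotoneOn_Ici_of_hasDerivAt (fun u hu => D.hasDerivAt_quadForm_C x hu) fun u hu => by
      simpa using (D.posSemidef_Cdot u hu).dotProduct_mulVec_nonneg x
  exact hmono (Set.mem_Ici.2 hs) (Set.mem_Ici.2 (hs.trans hst)) hst

/-- **`C_t − C_s` is positive semidefinite for `0 ≤ s ≤ t`** (the covariance of the scales between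
`s` and `t`, [BBD] Def 2's `E_{C_t−C_s}`). [cite: BauerschmidtBodineauDagallier2023, §3.1–3.2] -/
theorem posSemidef_C_sub {s t : ℝ} (hs : 0 ≤ s) (hst : s ≤ t) : (D.C t - D.C s).PosSemidef := by
  refine Matrix.PosSemidef.of_dotProduct_mulVec_nonneg
    ((D.isHermitian_C (hs.trans hst)).sub (D.isHermitian_C hs)) fun x => ?_
  rw [star_trivial, Matrix.sub_mulVec, dotProduct_sub, sub_nonneg]
  exact D.quadForm_C_mono x hs hst

/-- `C_t` is positive semidefinite for `t ≥ 0` (`C_0 = 0`).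
[cite: BauerschmidtBodineauDagallier2023, §3.1] -/
theorem posSemidef_C {t : ℝ} (ht : 0 ≤ t) : (D.C t).PosSemidef := by
  simpa [D.C_zero] using D.posSemidef_C_sub le_rfl ht

/-- `C_∞` is symmetric (entrywise limit of the symmetric `C_t`).
[cite: BauerschmidtBodineauDagallier2023, §3.1] -/
theorem Cinf_symm (i j : Fin N) : D.Cinf j i = D.Cinf i j := by
  refine tendsto_nhds_unique (D.tendsto_C j i) ?_
  refine (D.tendsto_C i j).congr' ?_
  filter_upwards [eventually_ge_atTop (0 : ℝ)] with t ht
  exact (D.C_symm ht i j).symm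

/-- The quadratic form of `C_t` converges to that of `C_∞`. [cite: BauerschmidtBodineauDagallier2023, §3.1] -/
theorem tendsto_quadForm_C (x : Fin N → ℝ) :
    Tendsto (fun t => x ⬝ᵥ (D.C t *ᵥ x)) atTop (𝓝 (x ⬝ᵥ (D.Cinf *ᵥ x))) := by
  have h1 : (fun s => x ⬝ᵥ (D.C s *ᵥ x)) = fun s => ∑ i, ∑ j, x i * (D.C s i j * x j) := by
    funext s
    simp only [dotProduct, Matrix.mulVec, Finset.mul_sum]
  have h2 : x ⬝ᵥ (D.Cinf *ᵥ x) = ∑ i, ∑ j, x i * (D.Cinf i j * x j) := by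
    simp only [dotProduct, Matrix.mulVec, Finset.mul_sum]
  rw [h1, h2]
  refine tendsto_finsetSum _ fun i _ => tendsto_finsetSum _ fun j _ => ?_
  exact ((D.tendsto_C i j).mul_const (x j)).const_mul (x i)

/-- **`C_∞ − C_t` is positive semidefinite for `t ≥ 0`** (the covariance of the scales above `t`,
[BBD] Def 2's `E_{C_∞−C_t}`; closedness of the positive cone under the limit `T → ∞` of `C_T − C_t`).
[cite: BauerschmidtBodineauDagallier2023, §3.1–3.2] -/
theorem posSemidef_Cinf_sub {t : ℝ} (ht : 0 ≤ t) : (D.Cinf - D.C t).PosSemidef := by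
  refine Matrix.PosSemidef.of_dotProduct_mulVec_nonneg ?_ fun x => ?_
  · refine Matrix.IsHermitian.ext fun i j => ?_
    simp only [Matrix.sub_apply, star_trivial]
    rw [D.Cinf_symm i j, D.C_symm ht i j]
  · rw [star_trivial, Matrix.sub_mulVec, dotProduct_sub, sub_nonneg]
    refine ge_of_tendsto (D.tendsto_quadForm_C x) ?_
    filter_upwards [eventually_ge_atTop t] with T hT
    exact D.quadForm_C_mono x ht hT

/-- `C_∞` is positive semidefinite. [cite: BauerschmidtBodineauDagallier2023, §3.1] -/
theorem posSemidef_Cinf : D.Cinf.PosSemidef := by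
  simpa [D.C_zero] using D.posSemidef_Cinf_sub le_rfl

end CovDecomposition

end Cov

/-! ### The renormalised potential `V_t` ([BBD] Definition 2 (e:V-def)) -/

section Potential

variable (D : CovDecomposition N) {V₀ : EuclideanSpace ℝ (Fin N) → ℝ}

/-- `e^{−V₀(φ + ·)}` is measurable for measurable `V₀`. [folklore] -/
private theorem measurable_exp_neg_shift (hV : Measurable V₀) (φ : EuclideanSpace ℝ (Fin N)) :
    Measurable fun ζ => Real.exp (-V₀ (φ + ζ)) :=
  (hV.comp (measurable_const_add φ)).neg.exp

/-- `|e^{−V₀(x)}| ≤ e^{−b}` when `b ≤ V₀`. [folklore] -/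
private theorem abs_exp_neg_le {b : ℝ} (hb : ∀ φ, b ≤ V₀ φ) (x : EuclideanSpace ℝ (Fin N)) :
    |Real.exp (-V₀ x)| ≤ Real.exp (-b) := by
  rw [abs_of_pos (Real.exp_pos _)]
  exact Real.exp_le_exp.2 (neg_le_neg (hb x))

variable (hV : Measurable V₀) {b : ℝ} (hb : ∀ φ, b ≤ V₀ φ)
include hV hb

/-- For `V₀` measurable and bounded below and ANY probability measure `P`, the partition function
`E_P[e^{−V₀(φ+ζ)}]` is positive. [cite: BauerschmidtBodineauDagallier2023, §3.2 (standing assumption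
«V₀ bounded below»)] -/
theorem integral_exp_neg_pos (P : Measure (EuclideanSpace ℝ (Fin N))) [IsProbabilityMeasure P]
    (φ : EuclideanSpace ℝ (Fin N)) : 0 < ∫ ζ, Real.exp (-V₀ (φ + ζ)) ∂P :=
  integral_exp_pos
    (integrable_of_abs_le (measurable_exp_neg_shift hV φ) fun ζ => abs_exp_neg_le hb (φ + ζ))

/-- … and at most `e^{−b}`. [cite: BauerschmidtBodineauDagallier2023, §3.2] -/
theorem integral_exp_neg_le (P : Measure (EuclideanSpace ℝ (Fin N))) [IsProbabilityMeasure P]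
    (φ : EuclideanSpace ℝ (Fin N)) : ∫ ζ, Real.exp (-V₀ (φ + ζ)) ∂P ≤ Real.exp (-b) := by
  calc ∫ ζ, Real.exp (-V₀ (φ + ζ)) ∂P ≤ ∫ _ζ, Real.exp (-b) ∂P :=
        integral_mono (integrable_of_abs_le (measurable_exp_neg_shift hV φ)
          fun ζ => abs_exp_neg_le hb (φ + ζ)) (integrable_const _)
          fun ζ => Real.exp_le_exp.2 (neg_le_neg (hb _))
    _ = Real.exp (-b) := by simp

/-- **`e^{−V_t(φ)} = E_{C_t}[e^{−V₀(φ+ζ)}]`** — the defining identity of the renormalised potential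
([BBD] Def 2 (e:V-def)), valid because the Gaussian expectation is positive.
[cite: BauerschmidtBodineauDagallier2023, Definition 2] -/
theorem exp_neg_renormPotential (t : ℝ) (φ : EuclideanSpace ℝ (Fin N)) :
    Real.exp (-renormPotential D V₀ t φ) =
      ∫ ζ, Real.exp (-V₀ (φ + ζ)) ∂(multivariateGaussian 0 (D.C t)) := by
  unfold renormPotential
  rw [neg_neg, Real.exp_log (integral_exp_neg_pos hV hb _ φ)]

/-- `e^{V_t(φ)} = 1 / E_{C_t}[e^{−V₀(φ+ζ)}]`. [cite: BauerschmidtBodineauDagallier2023, Definition 2] -/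
theorem exp_renormPotential_eq_inv (t : ℝ) (φ : EuclideanSpace ℝ (Fin N)) :
    Real.exp (renormPotential D V₀ t φ) =
      (∫ ζ, Real.exp (-V₀ (φ + ζ)) ∂(multivariateGaussian 0 (D.C t)))⁻¹ := by
  unfold renormPotential
  rw [Real.exp_neg, Real.exp_log (integral_exp_neg_pos hV hb _ φ)]

/-- `e^{−V_∞(φ)} = E_{C_∞}[e^{−V₀(φ+ζ)}]` ([BBD] Def 2, p0013 L47).
[cite: BauerschmidtBodineauDagallier2023, Definition 2] -/
theorem exp_neg_renormPotentialInf (φ : EuclideanSpace ℝ (Fin N)) :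
    Real.exp (-renormPotentialInf D V₀ φ) =
      ∫ ζ, Real.exp (-V₀ (φ + ζ)) ∂(multivariateGaussian 0 D.Cinf) := by
  unfold renormPotentialInf
  rw [neg_neg, Real.exp_log (integral_exp_neg_pos hV hb _ φ)]

/-- **The renormalised potential stays bounded below by the same constant**: `b ≤ V₀ ⟹ b ≤ V_t`
(so `e^{−V_t} ≤ e^{−b}`, which is what makes every `P_{s,t}` integral converge).
[cite: BauerschmidtBodineauDagallier2023, §3.2] -/
theorem le_renormPotential (t : ℝ) (φ : EuclideanSpace ℝ (Fin N)) : b ≤ renormPotential D V₀ t φ := by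
  have hI := integral_exp_neg_pos hV hb (multivariateGaussian 0 (D.C t)) φ
  have hle := integral_exp_neg_le hV hb (multivariateGaussian 0 (D.C t)) φ
  have hlog : Real.log (∫ ζ, Real.exp (-V₀ (φ + ζ)) ∂(multivariateGaussian 0 (D.C t))) ≤ -b :=
    (Real.log_le_iff_le_exp hI).2 hle
  unfold renormPotential
  linarith

omit hb in
/-- `V_t` is measurable (a parametric Gaussian integral of a jointly measurable integrand).
[cite: BauerschmidtBodineauDagallier2023, Definition 2] -/
theorem measurable_renormPotential (t : ℝ) : Measurable (renormPotential D V₀ t) := by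
  have hsm : StronglyMeasurable
      (Function.uncurry fun (φ ζ : EuclideanSpace ℝ (Fin N)) => Real.exp (-V₀ (φ + ζ))) :=
    (hV.comp (measurable_fst.add measurable_snd)).neg.exp.stronglyMeasurable
  have hm : Measurable fun φ : EuclideanSpace ℝ (Fin N) =>
      ∫ ζ, Real.exp (-V₀ (φ + ζ)) ∂(multivariateGaussian 0 (D.C t)) :=
    (hsm.integral_prod_right (ν := multivariateGaussian 0 (D.C t))).measurable
  exact (Real.measurable_log.comp hm).neg

omit hb in
/-- `x ↦ e^{−V_s(x)} F(x)` — the integrand of `P_{s,t}` and of `E_{ν_s}` — is measurable for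
measurable `F`. [cite: BauerschmidtBodineauDagallier2023, Definition 2] -/
theorem measurable_exp_neg_renormPotential_mul (s : ℝ) {F : EuclideanSpace ℝ (Fin N) → ℝ}
    (hF : Measurable F) :
    Measurable fun x => Real.exp (-renormPotential D V₀ s x) * F x :=
  ((measurable_renormPotential D hV s).neg.exp).mul hF

/-- `|e^{−V_s(x)} F(x)| ≤ e^{−b} K` for `|F| ≤ K` (the integrand of `P_{s,t}` is bounded, «`F` bounded»,
«`V₀` bounded below»). [cite: BauerschmidtBodineauDagallier2023, Definition 2] -/
theorem abs_exp_neg_renormPotential_mul_le (s : ℝ) {F : EuclideanSpace ℝ (Fin N) → ℝ} {K : ℝ}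
    (hK : ∀ x, |F x| ≤ K) (x : EuclideanSpace ℝ (Fin N)) :
    |Real.exp (-renormPotential D V₀ s x) * F x| ≤ Real.exp (-b) * K := by
  rw [abs_mul, abs_of_pos (Real.exp_pos _)]
  exact mul_le_mul (Real.exp_le_exp.2 (neg_le_neg (le_renormPotential D hV hb s x))) (hK x)
    (abs_nonneg _) (Real.exp_pos _).le

/-- **Semigroup property of the renormalised potentials**: for `0 ≤ s ≤ t`,
`e^{−V_t(φ)} = E_{C_t−C_s}[e^{−V_s(φ+ζ)}]`, i.e. `V_t` is the renormalised potential of `V_s` for the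
covariance `C_t − C_s` ([BBD] proof of Lemma 2, p0017 L8: «we recall from (e:V-def) that
`V_t(φ) = −log E_{C_t−C_s}[e^{−V_s(φ+ζ)}]`»; by `P_{C_t−C_s} ∗ P_{C_s} = P_{C_t}`).
[cite: BauerschmidtBodineauDagallier2023, Definition 2 / Lemma 2 (proof)] -/
theorem exp_neg_renormPotential_eq_integral_sub {s t : ℝ} (hs : 0 ≤ s) (hst : s ≤ t)
    (φ : EuclideanSpace ℝ (Fin N)) :
    Real.exp (-renormPotential D V₀ t φ) =
      ∫ w, Real.exp (-renormPotential D V₀ s (φ + w)) ∂(multivariateGaussian 0 (D.C t - D.C s)) := by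
  simp_rw [exp_neg_renormPotential D hV hb]
  have h := integral_gaussian_add_shift (D.posSemidef_C_sub hs hst) (D.posSemidef_C hs)
    ((hV.neg).exp) (fun x => abs_exp_neg_le hb x) φ
  rw [sub_add_cancel] at h
  exact h

/-- `V_t(φ) = −log E_{C_t−C_s}[e^{−V_s(φ+ζ)}]` for `0 ≤ s ≤ t` ([BBD] p0017 L8).
[cite: BauerschmidtBodineauDagallier2023, Lemma 2 (proof)] -/
theorem renormPotential_eq_neg_log_integral_sub {s t : ℝ} (hs : 0 ≤ s) (hst : s ≤ t)
    (φ : EuclideanSpace ℝ (Fin N)) :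
    renormPotential D V₀ t φ =
      -Real.log (∫ w, Real.exp (-renormPotential D V₀ s (φ + w))
        ∂(multivariateGaussian 0 (D.C t - D.C s))) := by
  rw [← exp_neg_renormPotential_eq_integral_sub D hV hb hs hst, Real.log_exp, neg_neg]

/-- The `t = ∞` form: `e^{−V_∞(φ)} = E_{C_∞−C_t}[e^{−V_t(φ+ζ)}]` for `t ≥ 0` (the identity behind the
normalisation `e^{V_∞(0)}` of `ν_t`, [BBD] Def 2 (e:nu-def-bis) and p0013 L47).
[cite: BauerschmidtBodineauDagallier2023, Definition 2] -/
theorem exp_neg_renormPotentialInf_eq_integral_sub {t : ℝ} (ht : 0 ≤ t)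
    (φ : EuclideanSpace ℝ (Fin N)) :
    Real.exp (-renormPotentialInf D V₀ φ) =
      ∫ w, Real.exp (-renormPotential D V₀ t (φ + w)) ∂(multivariateGaussian 0 (D.Cinf - D.C t)) := by
  simp_rw [exp_neg_renormPotential D hV hb, exp_neg_renormPotentialInf D hV hb]
  have h := integral_gaussian_add_shift (D.posSemidef_Cinf_sub ht) (D.posSemidef_C ht)
    ((hV.neg).exp) (fun x => abs_exp_neg_le hb x) φ
  rw [sub_add_cancel] at h
  exact h

end Potential

/-! ### The Polchinski semigroup `P_{s,t}` ([BBD] Definition 2 (e:P-def-bis), Proposition 8) -/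

section Semigroup

variable (D : CovDecomposition N) {V₀ : EuclideanSpace ℝ (Fin N) → ℝ}

/-- **`P_{t,t} = id`** ([BBD] Prop 8 (eq: semigroup): «the Gaussian measure with covariance `0` is
the Dirac measure at `0`»). [cite: BauerschmidtBodineauDagallier2023, Proposition 8] -/
theorem semigroup_self (t : ℝ) (F : EuclideanSpace ℝ (Fin N) → ℝ) (φ : EuclideanSpace ℝ (Fin N)) :
    semigroup D V₀ t t F φ = F φ := by
  unfold semigroup
  rw [sub_self, multivariateGaussian_zero_cov, integral_dirac, add_zero, ← mul_assoc,
    ← Real.exp_add, add_neg_cancel, Real.exp_zero, one_mul]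

/-- The explicit form of `P_{0,t}`: `P_{0,t}F(φ) = e^{V_t(φ)} E_{C_t}[e^{−V₀(φ+ζ)} F(φ+ζ)]`
(`V_0 = V₀`, `C_0 = 0`). [cite: BauerschmidtBodineauDagallier2023, Definition 2 (e:fluctuationmeasure-def)] -/
theorem semigroup_zero_eq (t : ℝ) (F : EuclideanSpace ℝ (Fin N) → ℝ) (φ : EuclideanSpace ℝ (Fin N)) :
    semigroup D V₀ 0 t F φ = Real.exp (renormPotential D V₀ t φ) *
      ∫ ζ, Real.exp (-V₀ (φ + ζ)) * F (φ + ζ) ∂(multivariateGaussian 0 (D.C t)) := by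
  unfold semigroup
  simp_rw [renormPotential_zero]
  rw [D.C_zero, sub_zero]

/-- **Positivity**: `F ≥ 0 ⟹ P_{s,t}F ≥ 0` ([BBD] Prop 8).
[cite: BauerschmidtBodineauDagallier2023, Proposition 8] -/
theorem semigroup_nonneg (s t : ℝ) {F : EuclideanSpace ℝ (Fin N) → ℝ} (hF : ∀ x, 0 ≤ F x)
    (φ : EuclideanSpace ℝ (Fin N)) : 0 ≤ semigroup D V₀ s t F φ := by
  unfold semigroup
  exact mul_nonneg (Real.exp_pos _).le
    (integral_nonneg fun ζ => mul_nonneg (Real.exp_pos _).le (hF _))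

variable (hV : Measurable V₀) {b : ℝ} (hb : ∀ φ, b ≤ V₀ φ)
include hV hb

/-- **`P_{s,t}1 = 1`** for `0 ≤ s ≤ t` ([BBD] Prop 8; this is the semigroup property of the
renormalised potentials). [cite: BauerschmidtBodineauDagallier2023, Proposition 8] -/
theorem semigroup_const_one {s t : ℝ} (hs : 0 ≤ s) (hst : s ≤ t) (φ : EuclideanSpace ℝ (Fin N)) :
    semigroup D V₀ s t (fun _ => 1) φ = 1 := by
  unfold semigroup
  simp_rw [mul_one]
  rw [← exp_neg_renormPotential_eq_integral_sub D hV hb hs hst, ← Real.exp_add, add_neg_cancel,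
    Real.exp_zero]

/-- **Contraction**: `|P_{s,t}F| ≤ K` whenever `|F| ≤ K`, `0 ≤ s ≤ t` ([BBD] proof of Prop 8:
«`‖P_{s,t}F‖_∞ ≤ ‖F‖_∞` for each bounded `F`»). [cite: BauerschmidtBodineauDagallier2023, Proposition 8 (proof)] -/
theorem abs_semigroup_le {s t : ℝ} (hs : 0 ≤ s) (hst : s ≤ t) {F : EuclideanSpace ℝ (Fin N) → ℝ}
    (hF : Measurable F) {K : ℝ} (hK : ∀ x, |F x| ≤ K) (φ : EuclideanSpace ℝ (Fin N)) :
    |semigroup D V₀ s t F φ| ≤ K := by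
  have hK0 : 0 ≤ K := (abs_nonneg _).trans (hK φ)
  unfold semigroup
  set P := multivariateGaussian 0 (D.C t - D.C s)
  have hint : Integrable (fun ζ => Real.exp (-renormPotential D V₀ s (φ + ζ)) * F (φ + ζ)) P :=
    integrable_of_abs_le ((measurable_exp_neg_renormPotential_mul D hV s hF).comp
      (measurable_const_add φ)) fun ζ => abs_exp_neg_renormPotential_mul_le D hV hb s hK (φ + ζ)
  have hint' : Integrable (fun ζ => Real.exp (-renormPotential D V₀ s (φ + ζ))) P :=
    integrable_of_abs_le ((measurable_renormPotential D hV s).comp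
      (measurable_const_add φ)).neg.exp fun ζ => by
        rw [abs_of_pos (Real.exp_pos _)]
        exact Real.exp_le_exp.2 (neg_le_neg (le_renormPotential D hV hb s _))
  have h1 : |∫ ζ, Real.exp (-renormPotential D V₀ s (φ + ζ)) * F (φ + ζ) ∂P| ≤
      K * ∫ ζ, Real.exp (-renormPotential D V₀ s (φ + ζ)) ∂P := by
    calc |∫ ζ, Real.exp (-renormPotential D V₀ s (φ + ζ)) * F (φ + ζ) ∂P|
        ≤ ∫ ζ, |Real.exp (-renormPotential D V₀ s (φ + ζ)) * F (φ + ζ)| ∂P :=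
          abs_integral_le_integral_abs
      _ ≤ ∫ ζ, K * Real.exp (-renormPotential D V₀ s (φ + ζ)) ∂P := by
          refine integral_mono hint.abs (hint'.const_mul K) fun ζ => ?_
          simp only
          rw [abs_mul, abs_of_pos (Real.exp_pos _), mul_comm]
          exact mul_le_mul_of_nonneg_right (hK _) (Real.exp_pos _).le
      _ = K * ∫ ζ, Real.exp (-renormPotential D V₀ s (φ + ζ)) ∂P := integral_const_mul _ _
  rw [abs_mul, abs_of_pos (Real.exp_pos _)]
  calc Real.exp (renormPotential D V₀ t φ) *
        |∫ ζ, Real.exp (-renormPotential D V₀ s (φ + ζ)) * F (φ + ζ) ∂P|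
      ≤ Real.exp (renormPotential D V₀ t φ) *
          (K * ∫ ζ, Real.exp (-renormPotential D V₀ s (φ + ζ)) ∂P) :=
        mul_le_mul_of_nonneg_left h1 (Real.exp_pos _).le
    _ = K * (Real.exp (renormPotential D V₀ t φ) * Real.exp (-renormPotential D V₀ t φ)) := by
        rw [exp_neg_renormPotential_eq_integral_sub D hV hb hs hst φ]; ring
    _ = K := by rw [← Real.exp_add, add_neg_cancel, Real.exp_zero, mul_one]

/-- **The semigroup law `P_{r,t}(P_{s,r}F) = P_{s,t}F`** for `0 ≤ s ≤ r ≤ t` and bounded measurable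
`F` ([BBD] (eq: semigroup structure) p0014 L40–44 and Prop 8 (eq: semigroup): «follows immediately
from the definition and the convolution property of Gaussian measures»).
[cite: BauerschmidtBodineauDagallier2023, Proposition 8] -/
theorem semigroup_comp {s r t : ℝ} (hs : 0 ≤ s) (hsr : s ≤ r) (hrt : r ≤ t)
    {F : EuclideanSpace ℝ (Fin N) → ℝ} (hF : Measurable F) {K : ℝ} (hK : ∀ x, |F x| ≤ K)
    (φ : EuclideanSpace ℝ (Fin N)) :
    semigroup D V₀ r t (semigroup D V₀ s r F) φ = semigroup D V₀ s t F φ := by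
  unfold semigroup
  congr 1
  have hr : 0 ≤ r := hs.trans hsr
  calc ∫ ζ, Real.exp (-renormPotential D V₀ r (φ + ζ)) *
          (Real.exp (renormPotential D V₀ r (φ + ζ)) *
            ∫ w, Real.exp (-renormPotential D V₀ s (φ + ζ + w)) * F (φ + ζ + w)
              ∂(multivariateGaussian 0 (D.C r - D.C s)))
          ∂(multivariateGaussian 0 (D.C t - D.C r))
      = ∫ ζ, ∫ w, Real.exp (-renormPotential D V₀ s (φ + ζ + w)) * F (φ + ζ + w)
            ∂(multivariateGaussian 0 (D.C r - D.C s)) ∂(multivariateGaussian 0 (D.C t - D.C r)) := by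
        refine integral_congr_ae (Eventually.of_forall fun ζ => ?_)
        simp only
        rw [← mul_assoc, ← Real.exp_add, neg_add_cancel, Real.exp_zero, one_mul]
    _ = ∫ x, Real.exp (-renormPotential D V₀ s (φ + x)) * F (φ + x)
          ∂(multivariateGaussian 0 (D.C t - D.C r + (D.C r - D.C s))) :=
        (integral_gaussian_add_shift (D.posSemidef_C_sub hr hrt) (D.posSemidef_C_sub hs hsr)
          (measurable_exp_neg_renormPotential_mul D hV s hF)
          (abs_exp_neg_renormPotential_mul_le D hV hb s hK) φ).symm
    _ = ∫ x, Real.exp (-renormPotential D V₀ s (φ + x)) * F (φ + x)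
          ∂(multivariateGaussian 0 (D.C t - D.C s)) := by rw [sub_add_sub_cancel]

/-- **The fluctuation-measure form of `P_{0,t}`** ([BBD] (e:fluctuationmeasure-def) p0013 L80–84):
`P_{0,t}F(φ) = E_{μ_t^φ}[F(φ + ζ)]`, where `μ_t^φ` is the Gaussian `P_{C_t}` tilted by `−V₀(φ + ·)`
(Mathlib `Measure.tilted`). [cite: BauerschmidtBodineauDagallier2023, Definition 2 (e:fluctuationmeasure-def)] -/
theorem semigroup_zero_eq_integral_tilted (t : ℝ) (F : EuclideanSpace ℝ (Fin N) → ℝ)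
    (φ : EuclideanSpace ℝ (Fin N)) :
    semigroup D V₀ 0 t F φ =
      ∫ ζ, F (φ + ζ) ∂((multivariateGaussian 0 (D.C t)).tilted fun ζ => -V₀ (φ + ζ)) := by
  rw [semigroup_zero_eq, integral_tilted, exp_renormPotential_eq_inv D hV hb t φ,
    ← integral_const_mul]
  refine integral_congr_ae (Eventually.of_forall fun ζ => ?_)
  simp only [smul_eq_mul]
  ring

end Semigroup

/-! ### The renormalised measure `ν_t` ([BBD] Definition 2 (e:nu-def-bis), Propositions 6 and 8) -/

section RenormMeasure

variable (D : CovDecomposition N) {V₀ : EuclideanSpace ℝ (Fin N) → ℝ}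

/-- `E_{ν_t}` is positive: `F ≥ 0 ⟹ E_{ν_t}[F] ≥ 0`. [cite: BauerschmidtBodineauDagallier2023, Definition 2] -/
theorem renormExpect_nonneg (t : ℝ) {F : EuclideanSpace ℝ (Fin N) → ℝ} (hF : ∀ x, 0 ≤ F x) :
    0 ≤ renormExpect D V₀ t F := by
  unfold renormExpect
  exact mul_nonneg (Real.exp_pos _).le
    (integral_nonneg fun ζ => mul_nonneg (Real.exp_pos _).le (hF _))

variable (hV : Measurable V₀) {b : ℝ} (hb : ∀ φ, b ≤ V₀ φ)
include hV hb

/-- The normalisation of `ν_t`: `e^{V_∞(0)} = 1 / E_{C_∞−C_t}[e^{−V_t}]` for every `t ≥ 0`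
([BBD] Def 2: «`e^{+V_∞(0)}` is the normalisation factor of the probability measure `ν_t`»).
[cite: BauerschmidtBodineauDagallier2023, Definition 2] -/
theorem exp_renormPotentialInf_zero_eq_inv {t : ℝ} (ht : 0 ≤ t) :
    Real.exp (renormPotentialInf D V₀ 0) =
      (∫ w, Real.exp (-renormPotential D V₀ t w) ∂(multivariateGaussian 0 (D.Cinf - D.C t)))⁻¹ := by
  have h := exp_neg_renormPotentialInf_eq_integral_sub D hV hb ht 0
  simp_rw [zero_add] at h
  rw [← h, Real.exp_neg, inv_inv]

/-- **`ν_t` as a measure**: `E_{ν_t}[F] = ∫ F d(P_{C_∞−C_t} tilted by −V_t)` for `t ≥ 0` — the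
renormalised measure of [BBD] Def 2 (e:nu-def-bis) is the `−V_t`-tilt (Mathlib `Measure.tilted`) of the
Gaussian `P_{C_∞−C_t}`. [cite: BauerschmidtBodineauDagallier2023, Definition 2 (e:nu-def-bis)] -/
theorem renormExpect_eq_integral_tilted {t : ℝ} (ht : 0 ≤ t) (F : EuclideanSpace ℝ (Fin N) → ℝ) :
    renormExpect D V₀ t F =
      ∫ ζ, F ζ ∂((multivariateGaussian 0 (D.Cinf - D.C t)).tilted
        fun ζ => -renormPotential D V₀ t ζ) := by
  unfold renormExpect
  rw [integral_tilted, exp_renormPotentialInf_zero_eq_inv D hV hb ht, ← integral_const_mul]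
  refine integral_congr_ae (Eventually.of_forall fun ζ => ?_)
  simp only [smul_eq_mul]
  ring

/-- `E_{ν_t}[1] = 1` (`ν_t` is a probability measure), `t ≥ 0`.
[cite: BauerschmidtBodineauDagallier2023, Definition 2] -/
theorem renormExpect_const_one {t : ℝ} (ht : 0 ≤ t) : renormExpect D V₀ t (fun _ => 1) = 1 := by
  unfold renormExpect
  simp_rw [mul_one]
  rw [exp_renormPotentialInf_zero_eq_inv D hV hb ht]
  exact inv_mul_cancel₀ (integral_exp_pos (integrable_of_abs_le
    (measurable_renormPotential D hV t).neg.exp fun w => by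
      rw [abs_of_pos (Real.exp_pos _)]
      exact Real.exp_le_exp.2 (neg_le_neg (le_renormPotential D hV hb t w)))).ne'

/-- **`ν_0 = ν₀`**: at `t = 0` the renormalised measure is the starting measure,
`E_{ν_0}[F] = ∫ F dν₀` with `ν₀ = P_{C_∞}` tilted by `−V₀` (`Polchinski.nu0`; `C_0 = 0`, `V_0 = V₀`).
[cite: BauerschmidtBodineauDagallier2023, Definition 2 / Proposition 6] -/
theorem renormExpect_zero (F : EuclideanSpace ℝ (Fin N) → ℝ) :
    renormExpect D V₀ 0 F = ∫ φ, F φ ∂(nu0 D V₀) := by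
  rw [renormExpect_eq_integral_tilted D hV hb le_rfl, nu0, D.C_zero, sub_zero]
  simp_rw [renormPotential_zero]

/-- **Duality `E_{ν_t}[P_{s,t}F] = E_{ν_s}[F]`** for `0 ≤ s ≤ t` and bounded measurable `F`
([BBD] Proposition 8, first identity of (e:polchinski-semigroup); BB21 Prop 1).
[cite: BauerschmidtBodineauDagallier2023, Proposition 8] -/
theorem renormExpect_semigroup {s t : ℝ} (hs : 0 ≤ s) (hst : s ≤ t)
    {F : EuclideanSpace ℝ (Fin N) → ℝ} (hF : Measurable F) {K : ℝ} (hK : ∀ x, |F x| ≤ K) :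
    renormExpect D V₀ t (semigroup D V₀ s t F) = renormExpect D V₀ s F := by
  unfold renormExpect semigroup
  congr 1
  have ht : 0 ≤ t := hs.trans hst
  calc ∫ ζ, Real.exp (-renormPotential D V₀ t ζ) *
          (Real.exp (renormPotential D V₀ t ζ) *
            ∫ w, Real.exp (-renormPotential D V₀ s (ζ + w)) * F (ζ + w)
              ∂(multivariateGaussian 0 (D.C t - D.C s)))
          ∂(multivariateGaussian 0 (D.Cinf - D.C t))
      = ∫ ζ, ∫ w, Real.exp (-renormPotential D V₀ s (ζ + w)) * F (ζ + w)
            ∂(multivariateGaussian 0 (D.C t - D.C s)) ∂(multivariateGaussian 0 (D.Cinf - D.C t)) := by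
        refine integral_congr_ae (Eventually.of_forall fun ζ => ?_)
        simp only
        rw [← mul_assoc, ← Real.exp_add, neg_add_cancel, Real.exp_zero, one_mul]
    _ = ∫ x, Real.exp (-renormPotential D V₀ s x) * F x
          ∂(multivariateGaussian 0 (D.Cinf - D.C t + (D.C t - D.C s))) :=
        (integral_gaussian_add (D.posSemidef_Cinf_sub ht) (D.posSemidef_C_sub hs hst)
          (measurable_exp_neg_renormPotential_mul D hV s hF)
          (abs_exp_neg_renormPotential_mul_le D hV hb s hK)).symm
    _ = ∫ x, Real.exp (-renormPotential D V₀ s x) * F x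
          ∂(multivariateGaussian 0 (D.Cinf - D.C s)) := by rw [sub_add_sub_cancel]

/-- **[BBD] Proposition 6: `E_{ν₀}[F] = E_{ν_t}[P_{0,t}F]`** for every `t ≥ 0` and bounded measurable
`F` — «integrating out the short scales boils down to considering a new test function `P_{0,t}F` and a
measure `ν_t`» (p0014 L14–17). [cite: BauerschmidtBodineauDagallier2023, Proposition 6] -/
theorem renormExpect_semigroup_zero {t : ℝ} (ht : 0 ≤ t)
    {F : EuclideanSpace ℝ (Fin N) → ℝ} (hF : Measurable F) {K : ℝ} (hK : ∀ x, |F x| ≤ K) :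
    renormExpect D V₀ t (semigroup D V₀ 0 t F) = ∫ φ, F φ ∂(nu0 D V₀) := by
  rw [renormExpect_semigroup D hV hb le_rfl ht hF hK, renormExpect_zero D hV hb]

/-- The two-step decomposition (eq: semigroup structure): for `0 ≤ s ≤ t`,
`E_{ν₀}[F] = E_{ν_s}[P_{0,s}F] = E_{ν_t}[P_{s,t}(P_{0,s}F)]` ([BBD] p0014 L40–44).
[cite: BauerschmidtBodineauDagallier2023, §3.2 (eq: semigroup structure)] -/
theorem renormExpect_semigroup_semigroup {s t : ℝ} (hs : 0 ≤ s) (hst : s ≤ t)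
    {F : EuclideanSpace ℝ (Fin N) → ℝ} (hF : Measurable F) {K : ℝ} (hK : ∀ x, |F x| ≤ K) :
    renormExpect D V₀ t (semigroup D V₀ s t (semigroup D V₀ 0 s F)) = ∫ φ, F φ ∂(nu0 D V₀) := by
  have hK0 : 0 ≤ K := (abs_nonneg _).trans (hK 0)
  have hPF : Measurable (semigroup D V₀ 0 s F) := by
    have h1 : Measurable fun φ : EuclideanSpace ℝ (Fin N) =>
        ∫ ζ, Real.exp (-renormPotential D V₀ 0 (φ + ζ)) * F (φ + ζ)
          ∂(multivariateGaussian 0 (D.C s - D.C 0)) := by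
      have hsm : StronglyMeasurable (Function.uncurry fun (φ ζ : EuclideanSpace ℝ (Fin N)) =>
          Real.exp (-renormPotential D V₀ 0 (φ + ζ)) * F (φ + ζ)) :=
        ((measurable_exp_neg_renormPotential_mul D hV 0 hF).comp
          (measurable_fst.add measurable_snd)).stronglyMeasurable
      exact (hsm.integral_prod_right (ν := multivariateGaussian 0 (D.C s - D.C 0))).measurable
    exact ((measurable_renormPotential D hV s).exp).mul h1
  rw [renormExpect_semigroup D hV hb hs hst hPF (fun φ => abs_semigroup_le D hV hb le_rfl hs hF hK φ),
    renormExpect_semigroup_zero D hV hb hs hF hK]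

/-- `ν₀` is a probability measure. [cite: BauerschmidtBodineauDagallier2023, §3.2 (e:nu0-Cinfty)] -/
theorem isProbabilityMeasure_nu0 : IsProbabilityMeasure (nu0 D V₀) := by
  unfold nu0
  exact isProbabilityMeasure_tilted (integrable_of_abs_le hV.neg.exp fun x => abs_exp_neg_le hb x)

end RenormMeasure

end Polchinski

end Literature.Analysis.FunctionSpaces

end
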